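import Summits.BirchSwinnertonDyer.Rank1Residual.GaloisImage.TransvectionNormalForm
import Literature.NumberTheory.EllipticCurves.Kato2004.Condition1252
import Literature.NumberTheory.EllipticCurves.KatzLatticeRationalTorsionProofs
import Literature.NumberTheory.EllipticCurves.IsogenyFrobeniusTraceProofs
import Literature.NumberTheory.GaloisCohomology.KolyvaginSystems
import Literature.NumberTheory.GaloisRepresentations.CyclotomicLevels
import HarnessLib

/-!
# Transvection normal form, Galois inputs: Sakamoto's `τ` ((H.2) + `τ ∈ G_{ℚ(μ_{p^m})}`) and a
# Frobenius at a Kolyvagin prime (`a_ℓ ≡ 2`, `ℓ ≡ 1 (mod p^m)`) both act on `T_pE` as `1 + N` with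
# `N² ≡ 0 (mod p^m)`, `N ≢ 0 (mod p)` (cell `b2b-bsdres`, team n1011, ROUTE-1 §25.4 (c) / R1-41,
# row T-B1 FILE 1b; seat p09 GEN 4)

HONEST FRAMING (cell `b2b-bsdres`, run/shared/lean/b2b/bsd-rank1-residual/, verbatim in every
file): the goal of the cell is to DELETE the COMBINATION-SHAPED residual classes of the
Birch–Swinnerton-Dyer formula for ALL analytic-rank `≤ 1` elliptic curves over `ℚ` — "full BSD
formula for every rank `≤ 1` curve in class `C`" assembled STRICTLY from published theorems — so
that the rank-`≤ 1` remainder becomes exactly the CONSTRUCTION-SHAPED classes, which are TYPED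
(missing-input `Prop`s), NOT attempted. This is not "finishing BSD". Team n1011 (N10/N11, the
additive block `X4 ∧ p = 3`): research route; TOOL theorems only (no definition, no named fact);
nothing here is a class theorem, no label changes, nothing is booked, no mark moves.

## What and why

`TransvectionNormalForm.lean` (R1-41, r1's CONVENTION LEMMA in `p`-adic form) conjugates modulo
`p^m` any two `2 × 2` matrices `N` over `ℤ_p` with `N² ≡ 0 (mod p^m)` and `N ≢ 0 (mod p)`.  This file
supplies the two Galois-theoretic instances of that shape on the Tate module `T_pE` of an elliptic
curve `E = W/ℚ` (`ρ = W.galoisRepTate p`, `b` any `ℤ_p`-basis), the inputs of bridge (B1)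
(`KolyvaginPrimeFrobeniusClass.lean`, p18 per lead R5-53):

* `smul_eq_self_of_galoisRepTate_eq_one_add` — `ρ(σ) = 1 + p^m D` on `T_pE` ⟹ `σ` fixes `E[p^m]`
  pointwise (`E[p^m] = π_m(T_pE)` over `ℚ̄`); hence (`m = 1`)
  `not_exists_toMatrix_sub_one_eq_p_smul_of_exists_smul_ne`: an element MOVING `E[p]` has
  `[ρ(σ)]_b − 1 ≢ 0 (mod p)`.
* `pow_dvd_det_galoisRepTate_sub_one_of_mem_rootsOfUnityFixer` — `τ ∈ G_{ℚ(μ_{p^m})}` ⟹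
  `det ρ(τ) ≡ 1 (mod p^m)` (`det ρ = χ_p`, Weil pairing; `χ_p(τ) ≡ 1` on a primitive `p^m`-th root).
* `pow_dvd_det_toMatrix_sub_one_of_cokerSubOne` — Sakamoto's (H.2) `E[p^m]/(τ − 1) ≃ ℤ/p^m` ⟹
  `det([ρ(τ)]_b − 1) ≡ 0 (mod p^m)` (adjugate: `det N` kills `T_pE/N T_pE`, hence the cyclic
  cokernel of order `p^m`).
* `tau_sq_eq_pow_smul_and_ne` / `frobenius_sq_eq_pow_smul_and_ne` — THE TWO INSTANCES: for `τ` as in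
  p13's `kolyvaginSystems_freeRankOne_propagatedSelmerStructure` (`hτμ`, `hτq`) moving `E[p]`, and for
  an arithmetic Frobenius `φ` at a good `ℓ ≠ p` with `p^m ∣ ℓ − 1`, `p^m ∣ a_ℓ − 2` moving `E[p]`
  (`tr ρ(φ) = a_ℓ`, `det ρ(φ) = ℓ`: Silverman C.21.3, tree
  `trace_galoisRepTate_frobenius_eq_frobeniusTrace` / `det_galoisRepTate_frobenius_of_hasGoodReductionAt_holds`),
  `N = [ρ(·)]_b − 1` satisfies `N² ≡ 0 (mod p^m)` and `N ≢ 0 (mod p)`.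
* `pow_dvd_det_one_add_pow_smul_sub_one`, `conj_add_smul_mul_add_smul` — `2 × 2` / algebra
  bookkeeping used downstream (`det (1 + p^m M) ≡ 1`; conjugation modulo `p^m`).

References: R. Sakamoto, JTNB 36 (2024) §2 (H.2) (p. 921) [Sakamoto2024]; J. H. Silverman, *AEC*
(2009) III.§7–§8, C.21.3 [SilvermanAEC2009]; cell files ROUTE-1 §25.4 (c), `cells/n1011/skel/T-B1.md`.
-/

noncomputable section

open scoped Classical NumberField Pointwise
open WeierstrassCurve Field NumberField IsDedekindDomain Rat.HeightOneSpectrum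
  Literature.NumberTheory.EllipticCurves Literature.NumberTheory.GaloisRepresentations
  Literature.NumberTheory.GaloisCohomology

namespace Summit.BirchSwinnertonDyer.Rank1Residual.GaloisImage.KolyvaginPrime

variable (W : WeierstrassCurve ℚ) [W.IsElliptic] (p : ℕ) [hp : Fact p.Prime]

/-! ### §1 `T_pE → E[p^m]`: congruences modulo `p^m` on `T_pE` read on the torsion -/

/-- Every point of `E[p^m]` is the `m`-th component of an element of `T_pE` (level spelt `(p:ℤ)^m`).
Silverman, *AEC*, III.§7. [folklore] -/
theorem exists_proj_eq (m : ℕ) (P : geomTorsion W ((p : ℤ) ^ m)) :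
    ∃ t : W.tateModule p, TateModule.proj p m t = (P : geomPoints W) := by
  have hP : (P : geomPoints W) ∈ geomTorsion W ((p ^ m : ℕ) : ℤ) := by
    rw [Nat.cast_pow]; exact P.2
  exact proj_surjective_of_isAlgClosed_holds W p m hP

omit [W.IsElliptic] in
/-- `π_m((p^m) • t) = 0`: the `m`-th component of a `p^m`-multiple vanishes. [folklore] -/
theorem proj_pow_smul_eq_zero (m : ℕ) (t : W.tateModule p) :
    TateModule.proj p m (((p : ℤ_[p]) ^ m) • t) = 0 := by
  rw [show ((p : ℤ_[p]) ^ m) • t = (p ^ m : ℕ) • t by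
    rw [← Nat.cast_smul_eq_nsmul ℤ_[p], Nat.cast_pow], map_nsmul]
  exact TateModule.pow_smul_proj m t

/-- **An element congruent to `1` modulo `p^m` on `T_pE` acts trivially on `E[p^m]`.** If
`ρ_{E,p}(σ) = 1 + p^m D` in `End_{ℤ_p}(T_pE)`, then `σ • P = P` for every `P ∈ E[p^m]`
(`E[p^m] = π_m(T_pE)` over `ℚ̄`, `π_m(p^m T_pE) = 0`). Silverman, *AEC*, III.§7. [folklore] -/
theorem smul_eq_self_of_galoisRepTate_eq_one_add {m : ℕ} {σ : absoluteGaloisGroup ℚ}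
    {D : W.tateModule p →ₗ[ℤ_[p]] W.tateModule p}
    (hσ : (W.galoisRepTate p σ : W.tateModule p →ₗ[ℤ_[p]] W.tateModule p) =
      1 + ((p : ℤ_[p]) ^ m) • D)
    (P : geomTorsion W ((p : ℤ) ^ m)) : σ • P = P := by
  obtain ⟨t, ht⟩ := exists_proj_eq W p m P
  apply Subtype.ext
  rw [AddSubgroup.torsionBy.coe_smul, ← ht, ← TateModule.proj_smul_of_distribMulAction,
    ← galoisRepTate_apply_apply, hσ, LinearMap.add_apply, Module.End.one_apply,
    LinearMap.smul_apply, map_add, proj_pow_smul_eq_zero, add_zero]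

/-- In particular (`m = 1`): if `[ρ(σ)]_b − 1 = p C` for some `ℤ_p`-basis `b` of `T_pE`, then `σ`
fixes `E[p]` pointwise.  Contrapositive: **an element MOVING `E[p]` has `[ρ(σ)]_b − 1 ≢ 0 (mod p)`** —
the second input of the transvection normal form. [folklore] -/
theorem not_exists_toMatrix_sub_one_eq_p_smul_of_exists_smul_ne
    (b : Module.Basis (Fin 2) ℤ_[p] (W.tateModule p)) {σ : absoluteGaloisGroup ℚ}
    (hσ : ∃ P : geomTorsion W (p : ℤ), σ • P ≠ P) :
    ¬ ∃ C : Matrix (Fin 2) (Fin 2) ℤ_[p],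
      LinearMap.toMatrix b b (W.galoisRepTate p σ) - 1 = (p : ℤ_[p]) • C := by
  rintro ⟨C, hC⟩
  obtain ⟨P, hP⟩ := hσ
  apply hP
  have hσ1 : (W.galoisRepTate p σ : W.tateModule p →ₗ[ℤ_[p]] W.tateModule p) =
      1 + ((p : ℤ_[p]) ^ 1) • Matrix.toLin b b C := by
    have h : LinearMap.toMatrix b b (W.galoisRepTate p σ) = 1 + (p : ℤ_[p]) • C := by
      rw [← hC]; abel
    have h2 := congrArg (Matrix.toLin b b) h
    rw [Matrix.toLin_toMatrix, map_add, map_smul, Matrix.toLin_one] at h2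
    rw [pow_one, Module.End.one_eq_id]
    exact h2
  have hP1 : (P : geomPoints W) ∈ geomTorsion W ((p : ℤ) ^ 1) := by rw [pow_one]; exact P.2
  have h3 := congrArg Subtype.val (smul_eq_self_of_galoisRepTate_eq_one_add W p hσ1 ⟨P, hP1⟩)
  apply Subtype.ext
  rw [AddSubgroup.torsionBy.coe_smul] at h3 ⊢
  exact h3


/-! ### §2 `2 × 2` bookkeeping -/

/-- `tr N ≡ 0 (mod p^m)` from `det (1 + N) ≡ 1` and `det N ≡ 0 (mod p^m)` (for `2 × 2` matrices
`det (1 + N) = 1 + tr N + det N`). [folklore] -/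
theorem pow_dvd_trace_of_pow_dvd_det {m : ℕ} (N : Matrix (Fin 2) (Fin 2) ℤ_[p])
    (h1 : (p : ℤ_[p]) ^ m ∣ (1 + N).det - 1) (h0 : (p : ℤ_[p]) ^ m ∣ N.det) :
    (p : ℤ_[p]) ^ m ∣ N.trace := by
  have hdet1 : (1 + N).det = 1 + N.trace + N.det := by
    rw [Matrix.det_fin_two, Matrix.det_fin_two, Matrix.trace_fin_two]
    simp only [Matrix.add_apply, Matrix.one_apply_eq,
      Matrix.one_apply_ne (show (0 : Fin 2) ≠ 1 by decide),
      Matrix.one_apply_ne (show (1 : Fin 2) ≠ 0 by decide)]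
    ring
  have h : N.trace = ((1 + N).det - 1) - N.det := by rw [hdet1]; ring
  rw [h]
  exact dvd_sub h1 h0

/-! ### §3 The `τ` side: Sakamoto's (H.2) and `τ ∈ G_{ℚ(μ_{p^m})}` read on `T_pE` -/

/-- **`det ρ_{E,p}(τ) ≡ 1 (mod p^m)` for `τ ∈ Gal(ℚ̄/ℚ(μ_{p^m}))`.**  `det ρ_{E,p} = χ_p` (Weil pairing,
tree `det_galoisRepTate_eq_cyclotomicCharacter` + `exists_weilPairing_holds`) and `χ_p(τ) ≡ 1
(mod p^m)` because `τ` fixes a primitive `p^m`-th root of unity (`GaloisRep.cyclotomicCharacter_spec`).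
[cite: SilvermanAEC2009, Prop. III.8.1 and Prop. III.8.3] -/
theorem pow_dvd_det_galoisRepTate_sub_one_of_mem_rootsOfUnityFixer {m : ℕ}
    {τ : absoluteGaloisGroup ℚ} (hτμ : τ ∈ rootsOfUnityFixer ℚ (p ^ m)) :
    (p : ℤ_[p]) ^ m ∣
      LinearMap.det (W.galoisRepTate p τ : W.tateModule p →ₗ[ℤ_[p]] W.tateModule p) - 1 := by
  have hpP : p.Prime := hp.out
  have hp0 : (p : ℚ) ≠ 0 := Nat.cast_ne_zero.mpr hpP.ne_zero
  haveI : NeZero (p : ℚ) := ⟨hp0⟩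
  rcases Nat.eq_zero_or_pos m with rfl | hm
  · rw [pow_zero]; exact one_dvd _
  haveI : Fact (1 < p ^ m) := ⟨Nat.one_lt_pow hm.ne' hpP.one_lt⟩
  -- a primitive `p^m`-th root of unity, fixed by `τ`
  obtain ⟨ζ, hζ⟩ := HasEnoughRootsOfUnity.exists_primitiveRoot (AlgebraicClosure ℚ) (p ^ m)
  have hζ1 : ζ ^ p ^ m = 1 := hζ.pow_eq_one
  have hspec : τ • ζ = ζ ^ (PadicInt.toZModPow m
      ((GaloisRep.cyclotomicCharacter ℚ p τ : ℤ_[p]ˣ) : ℤ_[p])).val :=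
    GaloisRep.cyclotomicCharacter_spec ℚ p (k := m) τ ζ hζ1
  have hfix : τ • ζ = ζ := (mem_rootsOfUnityFixer_iff.mp hτμ) ζ hζ1
  have key : PadicInt.toZModPow m ((GaloisRep.cyclotomicCharacter ℚ p τ : ℤ_[p]ˣ) : ℤ_[p]) = 1 := by
    apply ZMod.val_injective
    rw [ZMod.val_one]
    refine hζ.pow_inj (ZMod.val_lt _) (Nat.one_lt_pow hm.ne' hpP.one_lt) ?_
    rw [pow_one, ← hspec, hfix]
  have hdet := det_galoisRepTate_eq_cyclotomicCharacter W p hp0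
    (fun n => exists_weilPairing_holds W _) τ
  have hmem : LinearMap.det (W.galoisRepTate p τ : W.tateModule p →ₗ[ℤ_[p]] W.tateModule p) - 1 ∈
      RingHom.ker (PadicInt.toZModPow (p := p) m) := by
    rw [RingHom.mem_ker, map_sub, map_one, hdet, key, sub_self]
  rwa [PadicInt.ker_toZModPow, Ideal.mem_span_singleton] at hmem

/-- **`det([ρ(τ)]_b − 1) ≡ 0 (mod p^m)` from Sakamoto's (H.2) `E[p^m]/(τ − 1)E[p^m] ≃ ℤ/p^m`.**
With `N = [ρ(τ)]_b − 1` on `T_pE`: `N · adj N = det N`, so `det N · T_pE ⊆ N(T_pE)`; reducing by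
`π_m : T_pE ↠ E[p^m]` (equivariant), `det N` kills the cokernel of `τ − 1` on `E[p^m]`, which has an
element of order `p^m`; hence `p^m ∣ det N`. [cite: Sakamoto2024, §2 hypothesis (H.2) (p. 921)] -/
theorem pow_dvd_det_toMatrix_sub_one_of_cokerSubOne {m : ℕ}
    (b : Module.Basis (Fin 2) ℤ_[p] (W.tateModule p)) {τ : absoluteGaloisGroup ℚ}
    (hτq : Nonempty (cokerSubOne (W.torsionGaloisModule ((p : ℤ) ^ m)) τ ≃+ ZMod (p ^ m))) :
    (p : ℤ_[p]) ^ m ∣ (LinearMap.toMatrix b b (W.galoisRepTate p τ) - 1).det := by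
  obtain ⟨e⟩ := hτq
  set E := geomTorsion W ((p : ℤ) ^ m) with hE
  set N : Matrix (Fin 2) (Fin 2) ℤ_[p] := LinearMap.toMatrix b b (W.galoisRepTate p τ) - 1 with hN
  set d : ℤ_[p] := N.det with hd
  set d' : ℕ := (PadicInt.toZModPow m d).val with hd'
  set f : E →+ E := ((W.torsionGaloisModule ((p : ℤ) ^ m)) τ).toAddMonoidHom - AddMonoidHom.id E
    with hf
  -- `N ∘ adj N = d` on `T_pE`
  have hadj : ∀ t : W.tateModule p,
      (W.galoisRepTate p τ) (Matrix.toLin b b N.adjugate t) - Matrix.toLin b b N.adjugate t = d • t := by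
    intro t
    have h1 : Matrix.toLin b b N (Matrix.toLin b b N.adjugate t) = d • t := by
      rw [← LinearMap.comp_apply, ← Matrix.toLin_mul b b b, Matrix.mul_adjugate, map_smul,
        Matrix.toLin_one, LinearMap.smul_apply, LinearMap.id_apply]
    have h2 : Matrix.toLin b b N = (W.galoisRepTate p τ : W.tateModule p →ₗ[ℤ_[p]] W.tateModule p) - 1 := by
      rw [hN, map_sub, Matrix.toLin_toMatrix, Matrix.toLin_one, Module.End.one_eq_id]
    rw [h2, LinearMap.sub_apply, Module.End.one_apply] at h1
    exact h1
  -- `d' • P ∈ range f` for every `P ∈ E[p^m]`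
  have hrange : ∀ P : E, d' • P ∈ f.range := by
    intro P
    obtain ⟨t, ht⟩ := exists_proj_eq W p m P
    set s := Matrix.toLin b b N.adjugate t with hs
    have hsmem : TateModule.proj p m s ∈ geomTorsion W ((p : ℤ) ^ m) := by
      rw [← Nat.cast_pow]; exact proj_tateModule_mem_geomTorsion W p m s
    refine ⟨⟨TateModule.proj p m s, hsmem⟩, ?_⟩
    apply Subtype.ext
    have hval : ((f ⟨TateModule.proj p m s, hsmem⟩ : E) : geomPoints W) =
        τ • TateModule.proj p m s - TateModule.proj p m s := by
      rw [hf, AddMonoidHom.sub_apply, AddSubgroup.coe_sub, LinearMap.toAddMonoidHom_coe,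
        torsionGaloisModule_apply_apply, AddSubgroup.torsionBy.coe_smul, AddMonoidHom.id_apply]
    rw [hval, ← TateModule.proj_smul_of_distribMulAction, ← galoisRepTate_apply_apply, ← map_sub,
      hadj t, TateModule.proj_smul, ht, AddSubgroup.coe_nsmul]
  -- hence `d'` kills the cokernel, in particular its element `e⁻¹ 1` of order `p^m`
  have hkill : ∀ q : cokerSubOne (W.torsionGaloisModule ((p : ℤ) ^ m)) τ, d' • q = 0 := by
    intro q
    obtain ⟨P, rfl⟩ := QuotientAddGroup.mk_surjective q
    rw [← QuotientAddGroup.mk_nsmul, QuotientAddGroup.eq_zero_iff]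
    exact hrange P
  have hd'0 : (d' : ZMod (p ^ m)) = 0 := by
    have h := congrArg e (hkill (e.symm 1))
    rwa [map_nsmul, AddEquiv.apply_symm_apply, map_zero, nsmul_eq_mul, mul_one] at h
  have hd'z : d' = 0 := by
    refine Nat.eq_zero_of_dvd_of_lt ((ZMod.natCast_eq_zero_iff d' (p ^ m)).mp hd'0) ?_
    rw [hd']; exact ZMod.val_lt _
  have hdz : PadicInt.toZModPow m d = 0 := by
    rw [← ZMod.val_eq_zero, ← hd']; exact hd'z
  have hmem : d ∈ RingHom.ker (PadicInt.toZModPow (p := p) m) := by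
    rw [RingHom.mem_ker]; exact hdz
  rwa [PadicInt.ker_toZModPow, Ideal.mem_span_singleton] at hmem

/-- **The `τ` side of the conjugacy.**  For `τ ∈ Gal(ℚ̄/ℚ(μ_{p^m}))` with Sakamoto's (H.2)
`E[p^m]/(τ − 1) ≃ ℤ/p^m` (`m ≥ 1`) and MOVING `E[p]`, the matrix `N = [ρ(τ)]_b − 1` on `T_pE` satisfies
`N² ≡ 0 (mod p^m)` and `N ≢ 0 (mod p)` — the hypotheses of `Transvection.exists_conj_eq_std_add`.
[cite: Sakamoto2024, §2 hypothesis (H.2) (p. 921)] -/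
theorem tau_sq_eq_pow_smul_and_ne {m : ℕ} (b : Module.Basis (Fin 2) ℤ_[p] (W.tateModule p))
    {τ : absoluteGaloisGroup ℚ} (hτμ : τ ∈ rootsOfUnityFixer ℚ (p ^ m))
    (hτq : Nonempty (cokerSubOne (W.torsionGaloisModule ((p : ℤ) ^ m)) τ ≃+ ZMod (p ^ m)))
    (hτp : ∃ P : geomTorsion W (p : ℤ), τ • P ≠ P) :
    (∃ C : Matrix (Fin 2) (Fin 2) ℤ_[p],
        (LinearMap.toMatrix b b (W.galoisRepTate p τ) - 1) *
          (LinearMap.toMatrix b b (W.galoisRepTate p τ) - 1) = ((p : ℤ_[p]) ^ m) • C) ∧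
      ¬ ∃ C : Matrix (Fin 2) (Fin 2) ℤ_[p],
        LinearMap.toMatrix b b (W.galoisRepTate p τ) - 1 = (p : ℤ_[p]) • C := by
  refine ⟨?_, not_exists_toMatrix_sub_one_eq_p_smul_of_exists_smul_ne W p b hτp⟩
  set N := LinearMap.toMatrix b b (W.galoisRepTate p τ) - 1 with hN
  have hdet0 : (p : ℤ_[p]) ^ m ∣ N.det := pow_dvd_det_toMatrix_sub_one_of_cokerSubOne W p b hτq
  have hdet1 : (p : ℤ_[p]) ^ m ∣ (1 + N).det - 1 := by
    rw [hN, add_sub_cancel, LinearMap.det_toMatrix]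
    exact pow_dvd_det_galoisRepTate_sub_one_of_mem_rootsOfUnityFixer W p hτμ
  exact Transvection.sq_eq_pow_smul_of_dvd_trace_of_dvd_det N
    (pow_dvd_trace_of_pow_dvd_det p N hdet1 hdet0) hdet0

/-! ### §4 The Frobenius side: trace `a_ℓ ≡ 2`, determinant `ℓ ≡ 1 (mod p^m)` -/

/-- **The Frobenius side of the conjugacy.**  Let `W/ℚ` be globally minimal, `ℓ ≠ p` a prime of good
reduction, `v` the place at `ℓ`, `φ` an arithmetic Frobenius at a prime `𝔓 ∣ v` of `\bar ℤ`, with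
`p^m ∣ ℓ − 1`, `p^m ∣ a_ℓ − 2`, and `φ` MOVING `E[p]`.  Then `N = [ρ(φ)]_b − 1` on `T_pE` has
`N² ≡ 0 (mod p^m)` and `N ≢ 0 (mod p)`: `tr ρ(φ) = a_ℓ`, `det ρ(φ) = ℓ` on `T_pE` (Silverman C.21.3;
tree `trace_galoisRepTate_frobenius_eq_frobeniusTrace`,
`det_galoisRepTate_frobenius_of_hasGoodReductionAt_holds`) and Cayley–Hamilton.
[cite: SilvermanAEC2009, C.21 Remark 21.3] -/
theorem frobenius_sq_eq_pow_smul_and_ne [W.IsGloballyMinimal] {m : ℕ}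
    (b : Module.Basis (Fin 2) ℤ_[p] (W.tateModule p)) {ℓ : ℕ} [hℓ : Fact ℓ.Prime] (hℓp : ℓ ≠ p)
    (hgood : W.HasGoodReductionAtPrime ℓ) {v : HeightOneSpectrum (𝓞 ℚ)}
    (hv : (primesEquiv v : ℕ) = ℓ) {𝔓 : Ideal (absIntegers (𝓞 ℚ) ℚ)} (h𝔓 : 𝔓 ∈ v.primesAbove)
    {φ : absoluteGaloisGroup ℚ} (hφ : IsArithFrobAt (𝓞 ℚ) φ 𝔓)
    (h1 : ((p ^ m : ℕ) : ℤ) ∣ (ℓ : ℤ) - 1) (h2 : ((p ^ m : ℕ) : ℤ) ∣ W.frobeniusTrace ℓ - 2)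
    (hne : ∃ P : geomTorsion W (p : ℤ), φ • P ≠ P) :
    (∃ C : Matrix (Fin 2) (Fin 2) ℤ_[p],
        (LinearMap.toMatrix b b (W.galoisRepTate p φ) - 1) *
          (LinearMap.toMatrix b b (W.galoisRepTate p φ) - 1) = ((p : ℤ_[p]) ^ m) • C) ∧
      ¬ ∃ C : Matrix (Fin 2) (Fin 2) ℤ_[p],
        LinearMap.toMatrix b b (W.galoisRepTate p φ) - 1 = (p : ℤ_[p]) • C := by
  refine ⟨?_, not_exists_toMatrix_sub_one_eq_p_smul_of_exists_smul_ne W p b hne⟩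
  have hpP : p.Prime := hp.out
  have hne' : (primesEquiv v : ℕ) ≠ p := hv ▸ hℓp
  have hgood' : W.HasGoodReductionAt v :=
    (hasGoodReductionAtPrime_primesEquiv_iff_holds W v ℓ hv).mp hgood
  set G := LinearMap.toMatrix b b (W.galoisRepTate p φ) with hG
  have htrG : G.trace = (W.frobeniusTrace ℓ : ℤ_[p]) := by
    rw [hG, ← LinearMap.trace_eq_matrix_trace ℤ_[p] b,
      W.trace_galoisRepTate_frobenius_eq_frobeniusTrace p hne' hgood' h𝔓 hφ, hv]
  have hdetG : G.det = (ℓ : ℤ_[p]) := by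
    rw [hG, LinearMap.det_toMatrix, det_galoisRepTate_frobenius_of_hasGoodReductionAt_holds W p v
      (natCast_not_mem_asIdeal_of_primesEquiv_ne hpP hne') hgood' h𝔓 hφ,
      natCard_residueField_adicCompletionIntegers v, hv]
  set N := G - 1 with hN
  have hGN : 1 + N = G := by rw [hN]; abel
  refine Transvection.sq_eq_pow_smul_of_dvd_trace_sub_two_of_dvd_det_sub_one N ?_ ?_
  · rw [hGN, htrG]
    have h := (Int.castRingHom ℤ_[p]).map_dvd h2
    simpa using h
  · rw [hGN, hdetG]
    have h := (Int.castRingHom ℤ_[p]).map_dvd h1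
    simpa using h


/-! ### §5 Two more `2 × 2` facts: `det (1 + p^m M) ≡ 1`, and a conjugation identity -/

/-- `det (1 + p^m M) ≡ 1 (mod p^m)` for `2 × 2` matrices. [folklore] -/
theorem pow_dvd_det_one_add_pow_smul_sub_one (m : ℕ) (M : Matrix (Fin 2) (Fin 2) ℤ_[p]) :
    (p : ℤ_[p]) ^ m ∣ (1 + ((p : ℤ_[p]) ^ m) • M).det - 1 := by
  refine ⟨M.trace + (p : ℤ_[p]) ^ m * M.det, ?_⟩
  rw [Matrix.det_fin_two, Matrix.det_fin_two, Matrix.trace_fin_two]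
  simp only [Matrix.add_apply, Matrix.smul_apply, Matrix.one_apply_eq,
    Matrix.one_apply_ne (show (0 : Fin 2) ≠ 1 by decide),
    Matrix.one_apply_ne (show (1 : Fin 2) ≠ 0 by decide), smul_eq_mul]
  ring

/-- In an algebra, conjugating modulo `c`: `(B + c C′) Y (B′ + c C″) = B Y B′ + c D` for an explicit
`D`. [folklore] -/
theorem conj_add_smul_mul_add_smul {R A : Type*} [CommRing R] [Ring A] [Algebra R A] (c : R)
    (B B' C' C'' Y : A) :
    (B + c • C') * Y * (B' + c • C'') =
      B * Y * B' + c • (C' * Y * B' + B * Y * C'' + c • (C' * Y * C'')) := by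
  simp only [add_mul, mul_add, smul_mul_assoc, mul_smul_comm, smul_add, smul_smul]
  abel

end Summit.BirchSwinnertonDyer.Rank1Residual.GaloisImage.KolyvaginPrime

end
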